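import Summits.QuantumFields.YangMills.Theorems.VirialFluxGapRingFrameHessian
import HarnessLib

/-!
# Route `VirialFluxGap` (YangMills): TAYLOR LETTERS along the multi-direction translation curve of the ring group (toward the resolvent
# Euler field)

Toward the deciding crux `VirialFluxGap.PeriodicSoftness` (item stmt-QuantumFields-24141), generic-region Euler field `X_g = ½(H+λ⋆)⁻¹g`
(memo `fcl-p3-g40-RESOLVENT-EULER-FIELD-24141.md`).  The driving ∕ divergence estimates ✓`ResolventField.drive_lower_of_taylor` ∕
✓`ResolventField.divergence_upper` consume, at a point `P` with a nearby ZERO `p = P·exp(Y)` of `F₀`, the second-order Taylor relation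
`F₀(P) = ½uᵀHu − rᵀu + ρ₃`, the gradient relation `g = −Hu + r` and the Hessian drift `‖H(P) − H(p)‖ ≤ s`, with `|ρ₃|, |r|, s` bounded by
sup-norms of THIRD frame derivatives.  This file supplies the one-variable letters (crude constants — enough, every smallness condition of the
field is met by shrinking `t₀`):

* §1 MEAN-VALUE LETTERS for a real function with derivatives everywhere: `|γ(1) − γ(0)| ≤ K` (`|γ′| ≤ K` on `[0,1]`),
  `|γ(1) − γ(0) − γ′(0)| ≤ K` (`|γ″| ≤ K`), `|φ(1) − φ(0) − φ′(0) − ½φ″(0)| ≤ K` (`|φ‴| ≤ K`);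
* §2 along the multi-direction curve `s ↦ P·exp(sY)` (✓`FrameHessian.hasDerivAt_comp_multiCurve`): for every smooth function `f` of the
  coordinates, ★ `frame_taylor0` ∕ ★ `frame_taylor1` ∕ ★★ `frame_taylor2` — the three letters with `γ^{(k)} = frameD Y (⋯ (frameD Y f))`
  evaluated along the curve, the bound `K` being a sup of the next frame derivative over the ring space;
* §3 AT A ZERO `p = P·exp(Y)` of `F₀` (✓`frameD_ringPoly_eq_zero_of_zero`): ★★ `deficit_taylor_at_zero` —
  `|F₀(P) + ∂_Y F₀(P) + ½∂_Y∂_Y F₀(P)| ≤ K₃`, ★★ `gradient_taylor_at_zero` — `|∂_Z F₀(P) + ∂_Y∂_Z F₀(P)| ≤ K₂` for every direction `Z`, and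
  ★ `hessian_drift` — `|∂_Z∂_Z′F₀(P) − ∂_Z∂_Z′F₀(p)| ≤ K` (so the frame Hessian at `P` is within `K` of a positive-semidefinite, kernel-rich
  matrix — the inputs `s`, `(K)` of ✓`trace_resolvent_le`).

HONEST FRAMING: calculus bookkeeping; the polynomial values of the sup-norms (ambient derivative bounds of the quartic `ringPoly`), the basis
bookkeeping `Y = Σ u_j τ_j`, the kernel family and the field are NOT here; ⟨24141⟩ stays OPEN; no stub / crux / rung / summit is closed; the
Yang–Mills mass gap is NOT proved; no summit is proved by a line.  THEOREMS ONLY (0 `def`, 0 `sorry`), standard axioms.  Explicit-unit seat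
`ym-line-fcl-p3` g40 (cell ym-idea-1, free hands), `--supports stmt-QuantumFields-24141`.
References: [folklore] (Taylor–Lagrange letters); [cite: arXiv220412737, §2 (2.4) (p. 10)].
-/

set_option autoImplicit false

noncomputable section

open scoped Matrix BigOperators ContDiff Topology
open MeasureTheory Set Filter
open Literature.MathematicalPhysics.QuantumFieldTheory hiding SU2
open Literature.MathematicalPhysics.QuantumLattice
open Literature.MathematicalPhysics.QuantumFieldTheory.SUNBakryEmery (expSU coe_expSU matTop)

namespace Summit.QuantumFields.YangMills.Theorems.VirialFluxGap.FrameHessian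

open Summit.QuantumFields.YangMills.Theorems.FemtoTransferGap
open Summit.QuantumFields.YangMills.Theorems.FemtoTransferGap.TT
open Summit.QuantumFields.YangMills.Theorems.VirialFluxGap.RingDeficit
open Summit.QuantumFields.YangMills.Theorems.VirialFluxGap.FrameDerivative

/-! ## §1 Mean-value letters (crude Taylor remainders) -/

/-- Letter 0: `|γ(1) − γ(0)| ≤ K` when `γ` has a derivative everywhere with `|γ′| ≤ K` on `[0,1]`. [folklore] -/
theorem taylor0_letter {γ γ1 : ℝ → ℝ} {K : ℝ} (hγ : ∀ s, HasDerivAt γ (γ1 s) s) (hK : ∀ s ∈ Icc (0 : ℝ) 1, |γ1 s| ≤ K) :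
    |γ 1 - γ 0| ≤ K := by
  have h := norm_image_sub_le_of_norm_deriv_le_segment_01' (f := γ) (f' := γ1)
    (fun s _ => (hγ s).hasDerivWithinAt) (fun s hs => by
      rw [Real.norm_eq_abs]; exact hK s (Ico_subset_Icc_self hs))
  rwa [Real.norm_eq_abs] at h

/-- Letter 0 on `[0,x]`: `|γ(x) − γ(0)| ≤ K·x` for `x ∈ [0,1]`. [folklore] -/
theorem taylor0_letter_at {γ γ1 : ℝ → ℝ} {K : ℝ} (hγ : ∀ s, HasDerivAt γ (γ1 s) s) (hK : ∀ s ∈ Icc (0 : ℝ) 1, |γ1 s| ≤ K)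
    {x : ℝ} (hx : x ∈ Icc (0 : ℝ) 1) : |γ x - γ 0| ≤ K * x := by
  have h := norm_image_sub_le_of_norm_deriv_le_segment' (f := γ) (f' := γ1) (a := 0) (b := 1)
    (fun s _ => (hγ s).hasDerivWithinAt) (fun s hs => by
      rw [Real.norm_eq_abs]; exact hK s (Ico_subset_Icc_self hs)) x hx
  rwa [Real.norm_eq_abs, sub_zero] at h

/-- Letter 1: `|γ(1) − γ(0) − γ′(0)| ≤ K` when `γ′` has a derivative `γ″` everywhere with `|γ″| ≤ K` on `[0,1]`. [folklore] -/
theorem taylor1_letter {γ γ1 γ2 : ℝ → ℝ} {K : ℝ} (hγ : ∀ s, HasDerivAt γ (γ1 s) s) (hγ1 : ∀ s, HasDerivAt γ1 (γ2 s) s)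
    (hK : ∀ s ∈ Icc (0 : ℝ) 1, |γ2 s| ≤ K) : |γ 1 - γ 0 - γ1 0| ≤ K := by
  -- `ψ(s) = γ(s) − s·γ′(0)`, `ψ′(s) = γ′(s) − γ′(0)`, `|γ′(s) − γ′(0)| ≤ K·s ≤ K`
  have hψ : ∀ s, HasDerivAt (fun s => γ s - s * γ1 0) (γ1 s - γ1 0) s := fun s => by
    have h := (hγ s).fun_sub ((hasDerivAt_id' s).mul_const (γ1 0))
    simpa only [one_mul] using h
  have hbound : ∀ s ∈ Icc (0 : ℝ) 1, |γ1 s - γ1 0| ≤ K := fun s hs =>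
    (taylor0_letter_at hγ1 hK hs).trans (by nlinarith [hs.2, hs.1, hK 0 (left_mem_Icc.2 zero_le_one), abs_nonneg (γ2 0)])
  have h := taylor0_letter hψ hbound
  have h' : |(γ 1 - 1 * γ1 0) - (γ 0 - 0 * γ1 0)| ≤ K := h
  have e : (γ 1 - 1 * γ1 0) - (γ 0 - 0 * γ1 0) = γ 1 - γ 0 - γ1 0 := by ring
  rwa [e] at h'

/-- Letter 2: `|φ(1) − φ(0) − φ′(0) − ½φ″(0)| ≤ K` when `φ‴` exists everywhere with `|φ‴| ≤ K` on `[0,1]`. [folklore] -/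
theorem taylor2_letter {φ φ1 φ2 φ3 : ℝ → ℝ} {K : ℝ} (hφ : ∀ s, HasDerivAt φ (φ1 s) s) (hφ1 : ∀ s, HasDerivAt φ1 (φ2 s) s)
    (hφ2 : ∀ s, HasDerivAt φ2 (φ3 s) s) (hK : ∀ s ∈ Icc (0 : ℝ) 1, |φ3 s| ≤ K) :
    |φ 1 - φ 0 - φ1 0 - (1 / 2) * φ2 0| ≤ K := by
  have hK0 : 0 ≤ K := le_trans (abs_nonneg _) (hK 0 (left_mem_Icc.2 zero_le_one))
  -- `ψ(s) = φ(s) − sφ′(0) − ½s²φ″(0)`, `ψ′(s) = φ′(s) − φ′(0) − sφ″(0)`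
  have hψ : ∀ s, HasDerivAt (fun s => φ s - s * φ1 0 - 1 / 2 * s ^ 2 * φ2 0) (φ1 s - φ1 0 - s * φ2 0) s := by
    intro s
    have h1 : HasDerivAt (fun y : ℝ => y * φ1 0) (1 * φ1 0) s := (hasDerivAt_id' s).mul_const (φ1 0)
    have h2 : HasDerivAt (fun y : ℝ => 1 / 2 * y ^ 2 * φ2 0) (1 / 2 * ((2 : ℕ) * s ^ (2 - 1)) * φ2 0) s :=
      ((hasDerivAt_pow 2 s).const_mul (1 / 2 : ℝ)).mul_const (φ2 0)
    have h := ((hφ s).fun_sub h1).fun_sub h2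
    refine h.congr_deriv ?_
    push_cast
    ring
  -- bound on `ψ′`: letter 0 for `χ(t) = φ′(t) − tφ″(0)` on `[0,s]`
  have hbound : ∀ s ∈ Icc (0 : ℝ) 1, |φ1 s - φ1 0 - s * φ2 0| ≤ K := by
    intro s hs
    have hχ : ∀ t, HasDerivAt (fun t => φ1 t - t * φ2 0) (φ2 t - φ2 0) t := fun t => by
      have h := (hφ1 t).fun_sub ((hasDerivAt_id' t).mul_const (φ2 0))
      simpa only [one_mul] using h
    have hχb : ∀ t ∈ Icc (0 : ℝ) 1, |φ2 t - φ2 0| ≤ K := fun t ht =>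
      (taylor0_letter_at hφ2 hK ht).trans (by nlinarith [ht.2])
    have h := taylor0_letter_at hχ hχb hs
    have h' : |φ1 s - s * φ2 0 - (φ1 0 - 0 * φ2 0)| ≤ K * s := h
    rw [zero_mul, sub_zero] at h'
    calc |φ1 s - φ1 0 - s * φ2 0| = |φ1 s - s * φ2 0 - φ1 0| := by ring_nf
      _ ≤ K * s := h'
      _ ≤ K := by nlinarith [hs.2]
  have h := taylor0_letter hψ hbound
  have h' : |(φ 1 - 1 * φ1 0 - 1 / 2 * 1 ^ 2 * φ2 0) - (φ 0 - 0 * φ1 0 - 1 / 2 * 0 ^ 2 * φ2 0)| ≤ K := h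
  have e : (φ 1 - 1 * φ1 0 - 1 / 2 * 1 ^ 2 * φ2 0) - (φ 0 - 0 * φ1 0 - 1 / 2 * 0 ^ 2 * φ2 0) =
      φ 1 - φ 0 - φ1 0 - 1 / 2 * φ2 0 := by ring
  rwa [e] at h'

/-- Second-order condition at a minimum: if `φ ≥ φ(0)` everywhere, `φ` has a derivative `φ′(s)` at every `s` and `φ′` has derivative `a`
at `0`, then `0 ≤ a`. [folklore] -/
theorem second_deriv_nonneg_of_min {φ φ1 : ℝ → ℝ} {a : ℝ} (hmin : ∀ s, φ 0 ≤ φ s) (hφ : ∀ s, HasDerivAt φ (φ1 s) s)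
    (hφ1 : HasDerivAt φ1 a 0) : 0 ≤ a := by
  by_contra ha
  push Not at ha
  have h0 : φ1 0 = 0 := (IsLocalMin.hasDerivAt_eq_zero (Filter.Eventually.of_forall fun s => hmin s) (hφ 0))
  -- slope of `φ′` at `0` tends to `a < 0`: `φ′(s) < 0` for small `s > 0`
  have hslope := hφ1.tendsto_slope_zero_right
  have hev : ∀ᶠ t in 𝓝[>] (0 : ℝ), t⁻¹ • (φ1 (0 + t) - φ1 0) < a / 2 :=
    hslope (Iio_mem_nhds (by linarith : a < a / 2))
  rw [Filter.Eventually, mem_nhdsGT_iff_exists_Ioo_subset] at hev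
  obtain ⟨ε, hε, hsub⟩ := hev
  have hε0 : 0 < ε := hε
  have hneg : ∀ t ∈ Ioo (0 : ℝ) ε, φ1 t < 0 := by
    intro t ht
    have h := hsub ht
    simp only [mem_setOf_eq, zero_add, h0, sub_zero, smul_eq_mul] at h
    have ht0 : 0 < t := ht.1
    have : t⁻¹ * φ1 t < 0 := h.trans (by linarith)
    by_contra hcon
    push Not at hcon
    have := mul_nonneg (inv_pos.2 ht0).le hcon
    linarith
  -- mean value on `[0, ε/2]`
  obtain ⟨ξ, hξ, hslope'⟩ := exists_hasDerivAt_eq_slope φ φ1 (by linarith : (0 : ℝ) < ε / 2)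
    (fun s _ => (hφ s).continuousAt.continuousWithinAt) (fun s _ => hφ s)
  have hξneg : φ1 ξ < 0 := hneg ξ ⟨hξ.1, by linarith [hξ.2]⟩
  have : (φ (ε / 2) - φ 0) / (ε / 2 - 0) < 0 := by rw [← hslope']; exact hξneg
  have hnum : φ (ε / 2) - φ 0 < 0 := by
    have hden : (0 : ℝ) < ε / 2 - 0 := by linarith
    have := (div_neg_iff.1 this)
    rcases this with ⟨_, h2⟩ | ⟨h1, _⟩
    · linarith
    · linarith
  linarith [hmin (ε / 2)]

/-! ## §2 The letters along the multi-direction curve -/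

variable {L : ℕ} [NeZero L]

open scoped Matrix.Norms.Frobenius

attribute [local instance 2000] Literature.MathematicalPhysics.QuantumFieldTheory.SUNBakryEmery.matTop

/-- ★ Letter 0 along `P·exp(sY)`: `|f(p) − f(P)| ≤ K` for `p = P·exp(Y)`, `K` a sup of `|∂_Y f|` over the ring space. [folklore] -/
theorem frame_taylor0 {f : ((Fin (2 * L - 1 + 1) → Edge 3 L → Matrix (Fin 2) (Fin 2) ℂ) × (Site 3 L → Matrix (Fin 2) (Fin 2) ℂ)) → ℝ} (hf : ContDiff ℝ ∞ f) (Y : ((Fin (2 * L - 1 + 1) × Edge 3 L) ⊕ Site 3 L) → Matrix (Fin 2) (Fin 2) ℂ) (hY : ∀ w, (Y w)ᴴ = -Y w)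
    (hY0 : ∀ w, (Y w).trace = 0) (P : ((Fin (2 * L - 1 + 1) → GaugeConfig 3 L SU2) × (Site 3 L → SU2))) {K : ℝ} (hK : ∀ Q : ((Fin (2 * L - 1 + 1) → GaugeConfig 3 L SU2) × (Site 3 L → SU2)), |frameD Y f (ringCoord L Q)| ≤ K) :
    |f (ringCoord L (P * multiCurve Y hY hY0 1)) - f (ringCoord L P)| ≤ K := by
  have h := taylor0_letter (γ := fun s => f (ringCoord L (P * multiCurve Y hY hY0 s)))
    (fun s => hasDerivAt_comp_multiCurve hf Y hY hY0 P s) (fun s _ => hK _)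
  simpa [multiCurve_zero] using h

/-- ★ Letter 1 along `P·exp(sY)`: `|f(p) − f(P) − ∂_Y f(P)| ≤ K`, `K` a sup of `|∂_Y∂_Y f|`. [folklore] -/
theorem frame_taylor1 {f : ((Fin (2 * L - 1 + 1) → Edge 3 L → Matrix (Fin 2) (Fin 2) ℂ) × (Site 3 L → Matrix (Fin 2) (Fin 2) ℂ)) → ℝ} (hf : ContDiff ℝ ∞ f) (Y : ((Fin (2 * L - 1 + 1) × Edge 3 L) ⊕ Site 3 L) → Matrix (Fin 2) (Fin 2) ℂ) (hY : ∀ w, (Y w)ᴴ = -Y w)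
    (hY0 : ∀ w, (Y w).trace = 0) (P : ((Fin (2 * L - 1 + 1) → GaugeConfig 3 L SU2) × (Site 3 L → SU2))) {K : ℝ} (hK : ∀ Q : ((Fin (2 * L - 1 + 1) → GaugeConfig 3 L SU2) × (Site 3 L → SU2)), |frameD Y (frameD Y f) (ringCoord L Q)| ≤ K) :
    |f (ringCoord L (P * multiCurve Y hY hY0 1)) - f (ringCoord L P) - frameD Y f (ringCoord L P)| ≤ K := by
  have h := taylor1_letter (γ := fun s => f (ringCoord L (P * multiCurve Y hY hY0 s)))
    (γ1 := fun s => frameD Y f (ringCoord L (P * multiCurve Y hY hY0 s)))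
    (fun s => hasDerivAt_comp_multiCurve hf Y hY hY0 P s)
    (fun s => hasDerivAt_comp_multiCurve (contDiff_frameD hf Y) Y hY hY0 P s) (fun s _ => hK _)
  simpa [multiCurve_zero] using h

/-- ★★ Letter 2 along `P·exp(sY)`: `|f(p) − f(P) − ∂_Y f(P) − ½∂_Y∂_Y f(P)| ≤ K`, `K` a sup of `|∂_Y∂_Y∂_Y f|`. [folklore] -/
theorem frame_taylor2 {f : ((Fin (2 * L - 1 + 1) → Edge 3 L → Matrix (Fin 2) (Fin 2) ℂ) × (Site 3 L → Matrix (Fin 2) (Fin 2) ℂ)) → ℝ} (hf : ContDiff ℝ ∞ f) (Y : ((Fin (2 * L - 1 + 1) × Edge 3 L) ⊕ Site 3 L) → Matrix (Fin 2) (Fin 2) ℂ) (hY : ∀ w, (Y w)ᴴ = -Y w)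
    (hY0 : ∀ w, (Y w).trace = 0) (P : ((Fin (2 * L - 1 + 1) → GaugeConfig 3 L SU2) × (Site 3 L → SU2))) {K : ℝ} (hK : ∀ Q : ((Fin (2 * L - 1 + 1) → GaugeConfig 3 L SU2) × (Site 3 L → SU2)), |frameD Y (frameD Y (frameD Y f)) (ringCoord L Q)| ≤ K) :
    |f (ringCoord L (P * multiCurve Y hY hY0 1)) - f (ringCoord L P) - frameD Y f (ringCoord L P) -
        (1 / 2) * frameD Y (frameD Y f) (ringCoord L P)| ≤ K := by
  have h := taylor2_letter (φ := fun s => f (ringCoord L (P * multiCurve Y hY hY0 s)))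
    (φ1 := fun s => frameD Y f (ringCoord L (P * multiCurve Y hY hY0 s)))
    (φ2 := fun s => frameD Y (frameD Y f) (ringCoord L (P * multiCurve Y hY hY0 s)))
    (φ3 := fun s => frameD Y (frameD Y (frameD Y f)) (ringCoord L (P * multiCurve Y hY hY0 s)))
    (fun s => hasDerivAt_comp_multiCurve hf Y hY hY0 P s)
    (fun s => hasDerivAt_comp_multiCurve (contDiff_frameD hf Y) Y hY hY0 P s)
    (fun s => hasDerivAt_comp_multiCurve (contDiff_frameD (contDiff_frameD hf Y) Y) Y hY hY0 P s) (fun s _ => hK _)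
  simpa [multiCurve_zero] using h

/-! ## §3 At a zero of the deficit -/

/-- ★★ **The deficit's second-order Taylor relation at a point with a nearby zero**: if `p = P·exp(Y)` is a zero of `F₀`, then
`|F₀(P) + ∂_Y F₀(P) + ½∂_Y∂_Y F₀(P)| ≤ K₃` with `K₃` a sup of `|∂_Y³ F₀|` (letter 2 read backwards from the zero). [folklore] -/
theorem deficit_taylor_at_zero (Y : ((Fin (2 * L - 1 + 1) × Edge 3 L) ⊕ Site 3 L) → Matrix (Fin 2) (Fin 2) ℂ) (hY : ∀ w, (Y w)ᴴ = -Y w) (hY0 : ∀ w, (Y w).trace = 0) (P : ((Fin (2 * L - 1 + 1) → GaugeConfig 3 L SU2) × (Site 3 L → SU2)))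
    (hp : ringDeficit L (fun _ => false) (P * multiCurve Y hY hY0 1) = 0) {K₃ : ℝ}
    (hK : ∀ Q : ((Fin (2 * L - 1 + 1) → GaugeConfig 3 L SU2) × (Site 3 L → SU2)), |frameD Y (frameD Y (frameD Y (ringPoly L))) (ringCoord L Q)| ≤ K₃) :
    |ringDeficit L (fun _ => false) P + frameD Y (ringPoly L) (ringCoord L P) +
        (1 / 2) * frameD Y (frameD Y (ringPoly L)) (ringCoord L P)| ≤ K₃ := by
  have h := frame_taylor2 (contDiff_ringPoly (L := L)) Y hY hY0 P hK
  rw [← ringDeficit_eq_ringPoly, ← ringDeficit_eq_ringPoly, hp, zero_sub] at h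
  rw [← abs_neg]
  convert h using 2
  ring

/-- ★★ **The gradient's first-order Taylor relation at a point with a nearby zero**: if `p = P·exp(Y)` is a zero of `F₀`, then for EVERY
direction assignment `Z` (skew-Hermitian, traceless): `|∂_Z F₀(P) + ∂_Y∂_Z F₀(P)| ≤ K₂` with `K₂` a sup of `|∂_Y∂_Y∂_Z F₀|` — the components of
`g + Ĥu` where `Ĥ_YZ = ∂_Y∂_Z F₀` is the NON-symmetrised second derivative. [folklore] -/
theorem gradient_taylor_at_zero (Y Z : ((Fin (2 * L - 1 + 1) × Edge 3 L) ⊕ Site 3 L) → Matrix (Fin 2) (Fin 2) ℂ) (hY : ∀ w, (Y w)ᴴ = -Y w) (hY0 : ∀ w, (Y w).trace = 0)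
    (hZ : ∀ w, (Z w)ᴴ = -Z w) (hZ0 : ∀ w, (Z w).trace = 0) (P : ((Fin (2 * L - 1 + 1) → GaugeConfig 3 L SU2) × (Site 3 L → SU2)))
    (hp : ringDeficit L (fun _ => false) (P * multiCurve Y hY hY0 1) = 0) {K₂ : ℝ}
    (hK : ∀ Q : ((Fin (2 * L - 1 + 1) → GaugeConfig 3 L SU2) × (Site 3 L → SU2)), |frameD Y (frameD Y (frameD Z (ringPoly L))) (ringCoord L Q)| ≤ K₂) :
    |frameD Z (ringPoly L) (ringCoord L P) + frameD Y (frameD Z (ringPoly L)) (ringCoord L P)| ≤ K₂ := by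
  have h := frame_taylor1 (contDiff_frameD (contDiff_ringPoly (L := L)) Z) Y hY hY0 P hK
  rw [frameD_ringPoly_eq_zero_of_zero Z hZ hZ0 hp, zero_sub] at h
  rw [← abs_neg]
  convert h using 2
  ring

/-- ★ **Hessian drift**: `|∂_Z∂_Z′F₀(p) − ∂_Z∂_Z′F₀(P)| ≤ K` for `p = P·exp(Y)`, `K` a sup of `|∂_Y∂_Z∂_Z′F₀|`. [folklore] -/
theorem hessian_drift (Y Z Z' : ((Fin (2 * L - 1 + 1) × Edge 3 L) ⊕ Site 3 L) → Matrix (Fin 2) (Fin 2) ℂ) (hY : ∀ w, (Y w)ᴴ = -Y w) (hY0 : ∀ w, (Y w).trace = 0) (P : ((Fin (2 * L - 1 + 1) → GaugeConfig 3 L SU2) × (Site 3 L → SU2)))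
    {K : ℝ} (hK : ∀ Q : ((Fin (2 * L - 1 + 1) → GaugeConfig 3 L SU2) × (Site 3 L → SU2)), |frameD Y (frameD Z (frameD Z' (ringPoly L))) (ringCoord L Q)| ≤ K) :
    |frameD Z (frameD Z' (ringPoly L)) (ringCoord L (P * multiCurve Y hY hY0 1)) -
        frameD Z (frameD Z' (ringPoly L)) (ringCoord L P)| ≤ K :=
  frame_taylor0 (contDiff_frameD (contDiff_frameD (contDiff_ringPoly (L := L)) Z') Z) Y hY hY0 P hK

/-- ★ **The antisymmetric part of the second derivative is small near a zero**: `|∂_Y∂_Z F₀(P) − ∂_Z∂_Y F₀(P)| ≤ 2K` when `p = P·exp(W)` is a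
zero of `F₀` and `K` bounds `|∂_W∂_Y∂_Z F₀|` and `|∂_W∂_Z∂_Y F₀|` (the commutator `∂_{[Y,Z]}F₀` vanishes AT the zero; drift letter 0).
[folklore] -/
theorem antisymm_small_near_zero (W Y Z : ((Fin (2 * L - 1 + 1) × Edge 3 L) ⊕ Site 3 L) → Matrix (Fin 2) (Fin 2) ℂ) (hW : ∀ w, (W w)ᴴ = -W w) (hW0 : ∀ w, (W w).trace = 0)
    (hY : ∀ w, (Y w)ᴴ = -Y w) (hZ : ∀ w, (Z w)ᴴ = -Z w) (P : ((Fin (2 * L - 1 + 1) → GaugeConfig 3 L SU2) × (Site 3 L → SU2)))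
    (hp : ringDeficit L (fun _ => false) (P * multiCurve W hW hW0 1) = 0) {K : ℝ}
    (hK1 : ∀ Q : ((Fin (2 * L - 1 + 1) → GaugeConfig 3 L SU2) × (Site 3 L → SU2)), |frameD W (frameD Y (frameD Z (ringPoly L))) (ringCoord L Q)| ≤ K)
    (hK2 : ∀ Q : ((Fin (2 * L - 1 + 1) → GaugeConfig 3 L SU2) × (Site 3 L → SU2)), |frameD W (frameD Z (frameD Y (ringPoly L))) (ringCoord L Q)| ≤ K) :
    |frameD Y (frameD Z (ringPoly L)) (ringCoord L P) - frameD Z (frameD Y (ringPoly L)) (ringCoord L P)| ≤ 2 * K := by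
  have h1 := hessian_drift W Y Z hW hW0 P hK1
  have h2 := hessian_drift W Z Y hW hW0 P hK2
  have hsymm := frameD_frameD_symm_of_zero (L := L) hY hZ hp
  rw [abs_le] at h1 h2 ⊢
  constructor <;> linarith [h1.1, h1.2, h2.1, h2.2]

/-- ★ **Second frame derivatives are nonnegative at a zero**: `0 ≤ ∂_Y∂_Y F₀(p)` for every skew-Hermitian traceless assignment `Y` when
`F₀(p) = 0` (second-order condition at the minimum of `F₀ ≥ 0` along `p·exp(sY)`) — with ✓`frameD_frameD_symm_of_zero` the frame Hessian at a
zero is a symmetric positive-semidefinite form. [folklore] -/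
theorem hessian_nonneg_at_zero (Y : ((Fin (2 * L - 1 + 1) × Edge 3 L) ⊕ Site 3 L) → Matrix (Fin 2) (Fin 2) ℂ) (hY : ∀ w, (Y w)ᴴ = -Y w) (hY0 : ∀ w, (Y w).trace = 0)
    {p : ((Fin (2 * L - 1 + 1) → GaugeConfig 3 L SU2) × (Site 3 L → SU2))} (hp : ringDeficit L (fun _ => false) p = 0) :
    0 ≤ frameD Y (frameD Y (ringPoly L)) (ringCoord L p) := by
  have hφ : ∀ s, HasDerivAt (fun s => ringDeficit L (fun _ => false) (p * multiCurve Y hY hY0 s))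
      (frameD Y (ringPoly L) (ringCoord L (p * multiCurve Y hY hY0 s))) s := hasDerivAt_ringDeficit_multiCurve Y hY hY0 p
  have hφ1 : HasDerivAt (fun s => frameD Y (ringPoly L) (ringCoord L (p * multiCurve Y hY hY0 s)))
      (frameD Y (frameD Y (ringPoly L)) (ringCoord L (p * multiCurve Y hY hY0 0))) 0 :=
    hasDerivAt_comp_multiCurve (contDiff_frameD (contDiff_ringPoly (L := L)) Y) Y hY hY0 p 0
  rw [multiCurve_zero, mul_one] at hφ1
  refine second_deriv_nonneg_of_min (φ := fun s => ringDeficit L (fun _ => false) (p * multiCurve Y hY hY0 s)) ?_ hφ hφ1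
  intro s
  show ringDeficit L (fun _ => false) (p * multiCurve Y hY hY0 0) ≤ ringDeficit L (fun _ => false) (p * multiCurve Y hY hY0 s)
  rw [multiCurve_zero, mul_one, hp]
  exact ringDeficit_nonneg _ _

end Summit.QuantumFields.YangMills.Theorems.VirialFluxGap.FrameHessian

end
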